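import Summits.ResolutionOfSingularities.KangarooAtlas.MizutaniRootTowerDegree
import Summits.ResolutionOfSingularities.KangarooAtlas.MizutaniRationalField
import Mathlib.LinearAlgebra.FreeModule.Finite.Matrix
import HarnessLib

/-!
# The Hasse–Schmidt operators of a root tower form a `K`-basis of `End_L(K)` (Jacobson); composition rule

Cell topic `Summits/ResolutionOfSingularities/KangarooAtlas` (pub-rosobs); namespace
`Summit.ResolutionOfSingularities.KangarooAtlas.Mizutani`.  Infrastructure for Mizutani's Lemma 2.9 (Nagoya Math. J. 52
(1973) p. 92–94: «By a theorem of Jacobson, we can identify the ring `Diff(K/k^p)` with `Hom_{k^p}(K, K)` … To an element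
`Δ = Σ a_{ij} D_1^i D_2^j` of `Diff(K/k^p)` we associate a `(p,p)`-matrix»), in the tree's tower language: for a root tower
`h : IsRootTower L K q x a` (`q = p^e`, `K = L(a)`, `a_i^q = x_i ∈ L`, `[K : L] = q^s`) and its Hasse–Schmidt operators
`D^{(T)} = h.hsD T : K →ₗ[L] K` (`MizutaniRootTower.lean`; `D^{(T)} a^N = C(N,T) a^{N−T}`):

* `IsRootTower.span_boxMonomials_eq_top`, `IsRootTower.linearMap_ext_boxMonomials` — `L`-linear maps out of `K` are
  determined by their values on the box monomials `a^W`;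
* **`IsRootTower.hsD_hsD`** — the COMPOSITION RULE (iterativity) `D^{(S)} (D^{(T)} y) = C(S+T, T) · D^{(S+T)} y` for all
  `S, T` (both sides vanish when `S + T` leaves the box), from the binomial identity
  `C(n,t) C(n−t,s) = C(n,s+t) C(s+t,t)` (`choose_mul_choose_sub_eq`);
* **`IsRootTower.linearIndependent_hsD`** — the `q^s` operators `D^{(W)}`, `W` in the box, are `K`-LINEARLY INDEPENDENT in
  `End_L(K)` (with `K` acting on the values), by evaluation on `a^W` and induction on `|W|`;
* **`IsRootTower.finrank_end`**, **`IsRootTower.span_hsD_eq_top`**, `IsRootTower.hsDBasis` — `dim_K End_L(K) = q^s`, so they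
  form a `K`-BASIS: every `L`-linear endomorphism of `K` is a unique `K`-combination `Σ_W c_W D^{(W)}` (Jacobson's theorem
  «`Diff(K/L) = Hom_L(K,K)`» for purely inseparable extensions of bounded exponent, in the explicit form used by Mizutani).

References: [Mizutani1973HironakaGroupSchemes] Lemma 2.9 (p. 92–94) and its proof («by a theorem of Jacobson»);
[EGAIV4] Thm. 16.11.2 (Hasse–Schmidt operators of a `p`-basis; (16.11.2.2) iterativity).
-/

noncomputable section

open MvPolynomial Literature.AlgebraicGeometry.Resolution

namespace Summit.ResolutionOfSingularities.KangarooAtlas.Mizutani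

universe u

/-! ### A binomial identity -/

section Binomial

/-- `C(n,t) · C(n−t,s) = C(n,s+t) · C(s+t,t)` for all naturals (both sides vanish when `s + t > n`). [folklore] -/
theorem choose_mul_choose_sub_eq (n t s : ℕ) :
    n.choose t * (n - t).choose s = n.choose (s + t) * (s + t).choose t := by
  rw [Nat.choose_mul (n := n) (k := s + t) (s := t) (Nat.le_add_left t s), Nat.add_sub_cancel]

variable {ι : Type*} [Fintype ι]

/-- The multi-index form: `C(N,T) C(N−T,S) = C(N,S+T) C(S+T,T)`. [folklore] -/
theorem mchoose_mul_mchoose_sub_eq (N T S : ι →₀ ℕ) :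
    mchoose N T * mchoose (N - T) S = mchoose N (S + T) * mchoose (S + T) T := by
  classical
  rw [mchoose_eq_prod, mchoose_eq_prod, mchoose_eq_prod, mchoose_eq_prod, ← Finset.prod_mul_distrib,
    ← Finset.prod_mul_distrib]
  refine Finset.prod_congr rfl fun i _ => ?_
  rw [Finsupp.tsub_apply, Finsupp.add_apply]
  exact choose_mul_choose_sub_eq (N i) (T i) (S i)

end Binomial

section OperatorBasis

variable {L K : Type u} [Field L] [Field K] [Algebra L K] {s p e : ℕ} [hp : Fact p.Prime] [CharP K p]
  {x : Fin s → L} {a : Fin s → K}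

/-! ### Linear maps out of `K` are determined on the box monomials -/

omit [CharP K p] in
/-- The box monomials `a^W` span `K` over `L`. [cite: Mizutani1973HironakaGroupSchemes, Remark 2.10 (in-house proof §1.1: the L-basis a^W)] -/
theorem IsRootTower.span_boxMonomials_eq_top (h : IsRootTower L K (p ^ e) x a) :
    Submodule.span L (boxMonomials a (p ^ e)) = ⊤ :=
  Submodule.eq_top_iff'.mpr h.mem_span

omit [CharP K p] in
/-- Two `L`-linear maps out of `K` that agree on every box monomial `a^W` agree. [folklore] -/
theorem IsRootTower.linearMap_ext_boxMonomials (h : IsRootTower L K (p ^ e) x a) {M : Type*} [AddCommGroup M]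
    [Module L M] {Φ Ψ : K →ₗ[L] M}
    (hΦΨ : ∀ N : Fin s →₀ ℕ, InBox (p ^ e) N → Φ (∏ i, a i ^ N i) = Ψ (∏ i, a i ^ N i)) : Φ = Ψ :=
  LinearMap.ext_on h.span_boxMonomials_eq_top (by rintro _ ⟨N, hN, rfl⟩; exact hΦΨ N hN)

/-! ### The composition rule `D^{(S)} D^{(T)} = C(S+T,T) D^{(S+T)}` (`C(S+T,T) = C(S+T,S)`) -/

/-- A natural-number multiple passes through `D^{(S)}`. [folklore] -/
theorem IsRootTower.hsD_natCast_mul (h : IsRootTower L K (p ^ e) x a) (S : Fin s →₀ ℕ) (n : ℕ) (y : K) :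
    h.hsD S ((n : K) * y) = (n : K) * h.hsD S y := by
  rw [← nsmul_eq_mul, map_nsmul, nsmul_eq_mul]

/-- `D^{(S)}` on `a^{N−T}`-type monomials, uniformly in and out of the box: `D^{(S)} a^M = C(M,S) a^{M−S}` where the binomial
vanishes whenever the operator does. [cite: EGAIV4, Thm. 16.11.2 (16.11.2.1)] -/
theorem IsRootTower.hsD_prod_pow' (h : IsRootTower L K (p ^ e) x a) (S M : Fin s →₀ ℕ) (hM : InBox (p ^ e) M) :
    h.hsD S (∏ i, a i ^ M i) = (mchoose M S : K) * ∏ i, a i ^ (M i - S i) := by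
  by_cases hS : InBox (p ^ e) S
  · exact h.hsD_prod_pow hS M
  · rw [h.hsD_eq_zero_of_not_inBox hS]
    have hle : ¬ S ≤ M := by
      intro hle
      exact hS fun i => lt_of_le_of_lt (hle i) (hM i)
    rw [mchoose_eq_zero_of_not_le hle, Nat.cast_zero, zero_mul]

/-- **Composition rule (iterativity of the Hasse–Schmidt system of a `p`-basis)**: `D^{(S)}(D^{(T)} y) = C(S+T,T) · D^{(S+T)} y`
for all `S, T` and all `y ∈ K` (when `S + T` leaves the box both sides are `0`).
[cite: EGAIV4, Thm. 16.11.2 ((16.11.2.2): D_p ∘ D_q = ((p,q)) D_{p+q}); Mizutani1973HironakaGroupSchemes, Lemma 2.9 (proof, the ring Diff(K/k^p))] -/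
theorem IsRootTower.hsD_hsD (h : IsRootTower L K (p ^ e) x a) (S T : Fin s →₀ ℕ) (y : K) :
    h.hsD S (h.hsD T y) = (mchoose (S + T) T : K) * h.hsD (S + T) y := by
  suffices hfun : h.hsD S ∘ₗ h.hsD T = (mchoose (S + T) T : L) • h.hsD (S + T) by
    have := congrArg (fun Φ : K →ₗ[L] K => Φ y) hfun
    simp only [LinearMap.comp_apply, LinearMap.smul_apply] at this
    rw [this, Algebra.smul_def, map_natCast]
  refine h.linearMap_ext_boxMonomials fun N hN => ?_
  rw [LinearMap.comp_apply, LinearMap.smul_apply, Algebra.smul_def, map_natCast]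
  by_cases hT : InBox (p ^ e) T
  · rw [h.hsD_prod_pow hT N, h.hsD_natCast_mul]
    have hNT : InBox (p ^ e) (N - T) := fun i => by
      rw [Finsupp.tsub_apply]; exact lt_of_le_of_lt (Nat.sub_le _ _) (hN i)
    have e1 : (∏ i, a i ^ (N i - T i)) = ∏ i, a i ^ ((N - T) i) :=
      Finset.prod_congr rfl fun i _ => by rw [Finsupp.tsub_apply]
    rw [e1, h.hsD_prod_pow' S (N - T) hNT, h.hsD_prod_pow' (S + T) N hN, ← mul_assoc, ← mul_assoc,
      ← Nat.cast_mul, ← Nat.cast_mul, mchoose_mul_mchoose_sub_eq N T S, mul_comm (mchoose N (S + T))]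
    congr 1
    refine Finset.prod_congr rfl fun i _ => ?_
    congr 1
    rw [Finsupp.tsub_apply, Finsupp.add_apply]
    omega
  · rw [h.hsD_eq_zero_of_not_inBox hT, map_zero]
    have hST : ¬ InBox (p ^ e) (S + T) := by
      intro hST
      exact hT fun i => lt_of_le_of_lt (by rw [Finsupp.add_apply]; exact Nat.le_add_left _ _) (hST i)
    rw [h.hsD_eq_zero_of_not_inBox hST, mul_zero]

/-- Operator form of the composition rule: `D^{(S)} ∘ D^{(T)} = C(S+T,T) · D^{(S+T)}` in `End_L(K)` (the scalar acting on values).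
[cite: EGAIV4, Thm. 16.11.2 (16.11.2.2)] -/
theorem IsRootTower.hsD_comp (h : IsRootTower L K (p ^ e) x a) (S T : Fin s →₀ ℕ) :
    h.hsD S ∘ₗ h.hsD T = (mchoose (S + T) T : K) • h.hsD (S + T) := by
  ext y
  rw [LinearMap.comp_apply, LinearMap.smul_apply, smul_eq_mul]
  exact h.hsD_hsD S T y

/-- The Hasse–Schmidt operators commute: `D^{(S)} D^{(T)} = D^{(T)} D^{(S)}`. [cite: EGAIV4, Thm. 16.11.2 (16.11.2.2)] -/
theorem IsRootTower.hsD_comm (h : IsRootTower L K (p ^ e) x a) (S T : Fin s →₀ ℕ) (y : K) :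
    h.hsD S (h.hsD T y) = h.hsD T (h.hsD S y) := by
  rw [h.hsD_hsD, h.hsD_hsD, add_comm T S]
  congr 2
  rw [show S + T = T + S from add_comm S T, ← mchoose_mul_mchoose_sub_eq_symm]
  where
  /-- `C(S+T,T) = C(S+T,S)`. [folklore] -/
  mchoose_mul_mchoose_sub_eq_symm : mchoose (T + S) T = mchoose (T + S) S := by
    classical
    rw [mchoose_eq_prod, mchoose_eq_prod]
    refine Finset.prod_congr rfl fun i _ => ?_
    rw [Finsupp.add_apply, Nat.choose_symm_add]

/-! ### `K`-linear independence of the `D^{(W)}`, `W` in the box -/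

/-- Degrees strictly increase along `<` on `Fin s →₀ ℕ`. [folklore] -/
theorem degree_lt_of_lt {T N : Fin s →₀ ℕ} (hle : T ≤ N) (hne : T ≠ N) : T.degree < N.degree := by
  have hsum : T + (N - T) = N := add_tsub_cancel_of_le hle
  have hdeg : N.degree = T.degree + (N - T).degree := by
    rw [← map_add, hsum]
  have hpos : (N - T).degree ≠ 0 := by
    intro h0
    apply hne
    rw [← hsum, (Finsupp.degree_eq_zero_iff _).mp h0, add_zero]
  omega

/-- **The `q^s` Hasse–Schmidt operators `D^{(W)}`, `W ∈ [0,q)^s`, are `K`-linearly independent** in `End_L(K)` (with `K`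
acting on the values, `(c • Φ) y = c · Φ y`): a relation `Σ_W c_W D^{(W)} = 0` evaluated at `a^N` gives `c_N = 0` once
`c_T = 0` for `|T| < |N|` (the terms with `T ≰ N` vanish, `C(N,T) = 0`).
[cite: Mizutani1973HironakaGroupSchemes, Lemma 2.9 (proof: «ρ is an isomorphism from Diff(K/k^p) to the (p,p)-matrices … as vector spaces over K»)] -/
theorem IsRootTower.linearIndependent_hsD (h : IsRootTower L K (p ^ e) x a) :
    LinearIndependent K (fun W : Fin s → Fin (p ^ e) => h.hsD (finsuppOf W)) := by
  classical
  rw [Fintype.linearIndependent_iff]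
  intro g hg
  -- strong induction on the degree of the index
  suffices key : ∀ d : ℕ, ∀ W : Fin s → Fin (p ^ e), (finsuppOf W).degree = d → g W = 0 from
    fun W => key _ W rfl
  intro d
  induction d using Nat.strong_induction_on with
  | _ d ih =>
    intro W hW
    have hbox : InBox (p ^ e) (finsuppOf W) := fun i => by rw [finsuppOf_apply]; exact (W i).2
    -- evaluate the relation at `a^W`
    have heval := congrArg (fun Φ : K →ₗ[L] K => Φ (∏ i, a i ^ (finsuppOf W) i)) hg
    simp only [LinearMap.coe_sum, Finset.sum_apply, LinearMap.smul_apply, LinearMap.zero_apply,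
      smul_eq_mul] at heval
    rw [Finset.sum_eq_single W] at heval
    · rw [h.hsD_prod_pow hbox, mchoose_self, Nat.cast_one, one_mul] at heval
      have h1 : (∏ i, a i ^ ((finsuppOf W) i - (finsuppOf W) i)) = (1 : K) :=
        Finset.prod_eq_one fun i _ => by rw [Nat.sub_self, pow_zero]
      rw [h1, mul_one] at heval
      exact heval
    · intro W' _ hW'
      have hbox' : InBox (p ^ e) (finsuppOf W') := fun i => by rw [finsuppOf_apply]; exact (W' i).2
      rw [h.hsD_prod_pow hbox' (finsuppOf W)]
      by_cases hle : finsuppOf W' ≤ finsuppOf W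
      · -- strictly smaller degree: the coefficient vanishes by induction
        have hne : finsuppOf W' ≠ finsuppOf W := by
          intro heq
          apply hW'
          funext i
          apply Fin.ext
          have := congrArg (fun M : Fin s →₀ ℕ => M i) heq
          simpa using this
        have hlt : (finsuppOf W').degree < d := hW ▸ degree_lt_of_lt hle hne
        rw [ih _ hlt W' rfl, zero_mul]
      · rw [mchoose_eq_zero_of_not_le hle, Nat.cast_zero, zero_mul, mul_zero]
    · intro hW0
      exact absurd (Finset.mem_univ W) hW0

/-! ### Jacobson: the `D^{(W)}` form a `K`-basis of `End_L(K)` -/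

/-- **`dim_K End_L(K) = [K : L] = q^s`** (the `K`-structure by post-multiplication). [cite: Mizutani1973HironakaGroupSchemes, Lemma 2.9 (proof: dim_K Hom_{k^p}(K,K) = p²)] -/
theorem IsRootTower.finrank_end (h : IsRootTower L K (p ^ e) x a) :
    Module.finrank K (K →ₗ[L] K) = (p ^ e) ^ s := by
  haveI := h.finiteDimensional
  rw [Module.finrank_linearMap_self, h.finrank_eq]

/-- **JACOBSON'S THEOREM for the tower, explicit form**: the Hasse–Schmidt operators `D^{(W)}`, `W ∈ [0,q)^s`, SPAN `End_L(K)`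
over `K` — every `L`-linear endomorphism of `K` is a `K`-combination `Σ_W c_W D^{(W)}`, i.e. a differential operator of `K/L`.
[cite: Mizutani1973HironakaGroupSchemes, Lemma 2.9 (proof: «By a theorem of Jacobson, we can identify the ring Diff(K/k^p) with Hom_{k^p}(K,K)»)] -/
theorem IsRootTower.span_hsD_eq_top (h : IsRootTower L K (p ^ e) x a) :
    Submodule.span K (Set.range fun W : Fin s → Fin (p ^ e) => h.hsD (finsuppOf W)) = ⊤ := by
  haveI := h.finiteDimensional
  refine h.linearIndependent_hsD.span_eq_top_of_card_eq_finrank ?_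
  rw [h.finrank_end, Fintype.card_fun, Fintype.card_fin, Fintype.card_fin]

/-- The `K`-basis `(D^{(W)})_{W ∈ [0,q)^s}` of `End_L(K)`. [cite: Mizutani1973HironakaGroupSchemes, Lemma 2.9 (proof)] -/
noncomputable def IsRootTower.hsDBasis (h : IsRootTower L K (p ^ e) x a) :
    Module.Basis (Fin s → Fin (p ^ e)) K (K →ₗ[L] K) :=
  Module.Basis.mk h.linearIndependent_hsD (le_of_eq h.span_hsD_eq_top.symm)

/-- The basis vectors are the operators `D^{(W)}`. [folklore] -/
theorem IsRootTower.hsDBasis_apply (h : IsRootTower L K (p ^ e) x a) (W : Fin s → Fin (p ^ e)) :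
    h.hsDBasis W = h.hsD (finsuppOf W) :=
  Module.Basis.mk_apply _ _ _

/-- **Every `L`-linear endomorphism of `K` is a differential operator**: `Φ = Σ_W c_W D^{(W)}` with `c = h.hsDBasis.repr Φ`.
[cite: Mizutani1973HironakaGroupSchemes, Lemma 2.9 (proof, Jacobson)] -/
theorem IsRootTower.eq_sum_repr_hsD (h : IsRootTower L K (p ^ e) x a) (Φ : K →ₗ[L] K) :
    Φ = ∑ W, h.hsDBasis.repr Φ W • h.hsD (finsuppOf W) := by
  conv_lhs => rw [← h.hsDBasis.sum_repr Φ]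
  exact Finset.sum_congr rfl fun W _ => by rw [h.hsDBasis_apply]

end OperatorBasis

end Summit.ResolutionOfSingularities.KangarooAtlas.Mizutani

end
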